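import Literature.NumberTheory.EllipticCurves.FormalGroupNilIdealPoints
import Literature.NumberTheory.EllipticCurves.FormalGroupTranslation
import HarnessLib

/-!
# `P₀ + P(t) = (translateX(t), translateY(t))` in `E(K)` for a complete ultrametric field `K`: the `t`-expansion of
# `x(P₀ + P)`, `y(P₀ + P)` EVALUATED at a formal-group point (de Shalit II.4.9, proof of (ii); Silverman AEC VII.2.2)

Topic `Literature/NumberTheory/EllipticCurves` (theorems only; no definition, no named fact, no instance).  Notation of
`FormalGroupNilIdealPoints`: `K` a complete nontrivially normed ultrametric field, `𝒪_K = unitBall K`, `𝔪_K = ballNilIdeal K`,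
`W` a Weierstrass equation over a discrete coefficient ring `A` acting continuously on `𝒪_K`, `E = curveOver K W`,
`P(t) = ptOfZ K W t = (X(t)/t², −X(t)/t³) ∈ E₁(K)` (`X = formalXMulSq`), `evalAt 𝔪_K t : A⟦z⟧ → 𝒪_K` the topological
evaluation.  For an `A`-point `P₀ = (x₀, y₀)` (read in `E(K)`) and `t ∈ 𝔪_K ∖ 0`:

* §1 the translation identities of `FormalGroupTranslation` (`D·u = N`, `t²·x₃ = G`, `t·H = x₃ − x₀`, …) evaluated at `t`,
  `‖D(t)‖ = 1` (`D = X − x₀t²`), and `x₀ ≠ x(P(t))` (`‖x(P(t))‖ = ‖t‖⁻² > 1 ≥ ‖x₀‖`: the CHORD case, always);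
* §2 ★★ `some_add_ptOfZ` — **`P₀ + P(t) = (translateX x₀ y₀ (t), translateY x₀ y₀ (t))` in `E(K)`**: the `p`-adic twin of
  `some_add_laurentPt` (`E(k⸨t⸩)`, seat g12) — the translation SERIES, evaluated at the parameter of a point of `E₁(K)`, ARE the
  coordinates of the translate (same algebra: Mathlib's chord formulas `chord_addX_mul/chord_addY_mul` against the evaluated
  identities); `some_add_eq_of_mem_kernel` — the same for any `Q ∈ E₁(K)` at `t = z(Q)`;
* §3 ★ `some_sub_ptOfZ` — **`P₀ − P(t) = (((translateX x₀ y₀) ∘ i_W)(t), ((translateY x₀ y₀) ∘ i_W)(t))`** (`−P(t) = P(i_W t)`,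
  `neg_ptOfZ`; `(h ∘ i_W)(t) = h(i_W(t))`, `evalAt_subst₁`) — the form de Shalit uses: the `t`-expansion of
  `P ↦ Θ(Ω − z(P)) = Θ_𝔞(P₀ − P)` is built from `x(P₀ − P(t)) = ((translateX x₀ y₀) ∘ i_W)(t)`, and II.4.9 (ii) evaluates it at the
  torsion points `ω_n = t(ξ(u_n))` of `Ê`.
Cell `bsd-print-cf2`, seat `bsd-line-cf2c-w4` g13 (B6 ingredient (ii-δ), core); nothing about elliptic curves over number fields
is proved here; BSD is not proved by any of this.

## References
* [deShalit1987] E. de Shalit, *Iwasawa theory of elliptic curves with complex multiplication* (1987), II §4.9 Proposition,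
  proof of (ii) («In the `t`-expansion of this function … substitute `t = ω_n`», p. 63), II §4.4 (12).
* [SilvermanAEC2009] J. H. Silverman, *The Arithmetic of Elliptic Curves*, 2nd ed. (2009), III.2.3 (group law), IV.1, Prop. VII.2.2.
-/

noncomputable section

open scoped Classical NNReal
open PowerSeries

namespace Literature.NumberTheory.EllipticCurves

open Literature.NumberTheory.GaloisRepresentations.LubinTate
open Literature.NumberTheory.EllipticCurves.FormalGroupChart _root_.WeierstrassCurve

variable {A : Type*} [CommRing A] [UniformSpace A] [DiscreteUniformity A]
  {K : Type*} [NontriviallyNormedField K] [IsUltrametricDist K] [CompleteSpace K]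
  [Algebra A (unitBall K)] [ContinuousSMul A (unitBall K)] {W : WeierstrassCurve A}

/-! ## §1 The translation identities at `t`; the chord hypothesis -/

omit [UniformSpace A] [DiscreteUniformity A] [CompleteSpace K] [ContinuousSMul A (unitBall K)] in
/-- `‖x₀‖ ≤ 1` for the image in `K` of a coefficient (`𝒪_K`-valued). [cite: SilvermanAEC2009, VII.1] -/
theorem norm_cK_le_one (a : A) : ‖cK K a‖ ≤ 1 := norm_coe_unitBall_le_one _

/-- `D(t) = X(t) − x₀t²` (`D = translateDen`). [cite: deShalit1987, II §4.9 (proof of (i))] -/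
theorem coe_evalAt_translateDen (x₀ : A) (t : (ballNilIdeal K).toIdeal) :
    ((evalAt (ballNilIdeal K) t (W.translateDen x₀) : unitBall K) : K) = evX W t - cK K x₀ * ((t : unitBall K) : K) ^ 2 := by
  rw [translateDen, map_sub, map_mul, map_pow, evalAt_X', evalAt_C']
  rfl

/-- `N(t) = X(t) + y₀t³` (`N = translateNum`). [cite: deShalit1987, II §4.9 (proof of (i))] -/
theorem coe_evalAt_translateNum (y₀ : A) (t : (ballNilIdeal K).toIdeal) :
    ((evalAt (ballNilIdeal K) t (W.translateNum y₀) : unitBall K) : K) = evX W t + cK K y₀ * ((t : unitBall K) : K) ^ 3 := by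
  rw [translateNum, map_add, map_mul, map_pow, evalAt_X', evalAt_C']
  rfl

/-- **`‖D(t)‖ = 1`** (`‖X(t)‖ = 1`, `‖x₀t²‖ < 1`). [cite: SilvermanAEC2009, IV.1] -/
theorem norm_evalAt_translateDen (x₀ : A) (t : (ballNilIdeal K).toIdeal) :
    ‖((evalAt (ballNilIdeal K) t (W.translateDen x₀) : unitBall K) : K)‖ = 1 := by
  rw [coe_evalAt_translateDen]
  have ht := norm_lt_one_of_mem t
  have hlt : ‖cK K x₀ * ((t : unitBall K) : K) ^ 2‖ < 1 := by
    rw [norm_mul, norm_pow]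
    calc ‖cK K x₀‖ * ‖((t : unitBall K) : K)‖ ^ 2 ≤ 1 * ‖((t : unitBall K) : K)‖ ^ 2 := by
          gcongr; exact norm_cK_le_one x₀
      _ < 1 := by rw [one_mul]; exact pow_lt_one₀ (norm_nonneg _) ht (by norm_num)
  have hne : ‖evX W t‖ ≠ ‖-(cK K x₀ * ((t : unitBall K) : K) ^ 2)‖ := by
    rw [norm_neg, norm_evX]; exact (ne_of_lt hlt).symm
  rw [sub_eq_add_neg, IsUltrametricDist.norm_add_eq_max_of_norm_ne_norm hne, norm_evX, norm_neg]
  exact max_eq_left hlt.le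

/-- `D(t) ≠ 0`. [cite: SilvermanAEC2009, IV.1] -/
theorem evalAt_translateDen_ne_zero (x₀ : A) (t : (ballNilIdeal K).toIdeal) :
    ((evalAt (ballNilIdeal K) t (W.translateDen x₀) : unitBall K) : K) ≠ 0 := by
  rw [← norm_ne_zero_iff, norm_evalAt_translateDen]; exact one_ne_zero

/-- **The chord case is automatic: `x₀ ≠ x(P(t))`** for `t ≠ 0` (`‖x(P(t))‖ = ‖t‖⁻² > 1 ≥ ‖x₀‖`).
[cite: SilvermanAEC2009, Prop. VII.2.2] -/
theorem cK_ne_x_ptOfZ (x₀ : A) {t : (ballNilIdeal K).toIdeal} (ht0 : ((t : unitBall K) : K) ≠ 0) :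
    cK K x₀ ≠ evX W t / ((t : unitBall K) : K) ^ 2 := by
  intro h
  have h1 : ‖evX W t / ((t : unitBall K) : K) ^ 2‖ ≤ 1 := h ▸ norm_cK_le_one x₀
  rw [norm_div, norm_pow, norm_evX] at h1
  have h0 : 0 < ‖((t : unitBall K) : K)‖ := norm_pos_iff.mpr ht0
  have ht := norm_lt_one_of_mem t
  rw [div_le_iff₀ (pow_pos h0 2), one_mul] at h1
  nlinarith

/-- `x₀ − x(P(t)) = −D(t)/t²`. [cite: SilvermanAEC2009, IV.1] -/
theorem cK_sub_x_ptOfZ (x₀ : A) {t : (ballNilIdeal K).toIdeal} (ht0 : ((t : unitBall K) : K) ≠ 0) :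
    cK K x₀ - evX W t / ((t : unitBall K) : K) ^ 2 =
      -((evalAt (ballNilIdeal K) t (W.translateDen x₀) : unitBall K) : K) / ((t : unitBall K) : K) ^ 2 := by
  rw [coe_evalAt_translateDen]
  field_simp
  ring

/-- `y₀ − y(P(t)) = N(t)/t³`. [cite: SilvermanAEC2009, IV.1] -/
theorem cK_sub_y_ptOfZ (y₀ : A) {t : (ballNilIdeal K).toIdeal} (ht0 : ((t : unitBall K) : K) ≠ 0) :
    cK K y₀ - -evX W t / ((t : unitBall K) : K) ^ 3 =
      ((evalAt (ballNilIdeal K) t (W.translateNum y₀) : unitBall K) : K) / ((t : unitBall K) : K) ^ 3 := by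
  rw [coe_evalAt_translateNum]
  field_simp
  ring

/-- `D(t)·u(t) = N(t)` (`translateDen_mul_translateSlopeNum` at `t`). [cite: deShalit1987, II §4.9 (proof of (i))] -/
theorem evalAt_translateDen_mul_translateSlopeNum (x₀ y₀ : A) (t : (ballNilIdeal K).toIdeal) :
    ((evalAt (ballNilIdeal K) t (W.translateDen x₀) : unitBall K) : K) *
        ((evalAt (ballNilIdeal K) t (W.translateSlopeNum x₀ y₀) : unitBall K) : K) =
      ((evalAt (ballNilIdeal K) t (W.translateNum y₀) : unitBall K) : K) := by
  rw [← Subring.coe_mul, ← map_mul, W.translateDen_mul_translateSlopeNum]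

/-- `t²·x₃(t) = G(t)` (`X_sq_mul_translateX` at `t`). [cite: deShalit1987, II §4.9 (proof of (i))] -/
theorem sq_mul_evalAt_translateX (x₀ y₀ : A) (t : (ballNilIdeal K).toIdeal) :
    ((t : unitBall K) : K) ^ 2 * ((evalAt (ballNilIdeal K) t (W.translateX x₀ y₀) : unitBall K) : K) =
      ((evalAt (ballNilIdeal K) t (W.translateXAux x₀ y₀) : unitBall K) : K) := by
  have h := congrArg (fun f => ((evalAt (ballNilIdeal K) t f : unitBall K) : K)) (W.X_sq_mul_translateX x₀ y₀)
  simp only [map_mul, map_pow, evalAt_X', Subring.coe_mul, SubmonoidClass.coe_pow] at h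
  exact h

/-- `G(t) = u² − a₁tu − X − (a₂ + x₀)t²` at `t` (the definition of `translateXAux`). [cite: deShalit1987, II §4.9 (proof of (i))] -/
theorem coe_evalAt_translateXAux (x₀ y₀ : A) (t : (ballNilIdeal K).toIdeal) :
    ((evalAt (ballNilIdeal K) t (W.translateXAux x₀ y₀) : unitBall K) : K) =
      ((evalAt (ballNilIdeal K) t (W.translateSlopeNum x₀ y₀) : unitBall K) : K) ^ 2 -
        cK K W.a₁ * ((t : unitBall K) : K) * ((evalAt (ballNilIdeal K) t (W.translateSlopeNum x₀ y₀) : unitBall K) : K) -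
        evX W t - (cK K W.a₂ + cK K x₀) * ((t : unitBall K) : K) ^ 2 := by
  rw [translateXAux, map_sub, map_sub, map_sub, map_pow, map_mul, map_mul, map_mul, map_pow, evalAt_X', evalAt_C', evalAt_C',
    map_add]
  simp only [AddSubgroupClass.coe_sub, Subring.coe_mul, SubmonoidClass.coe_pow, Subring.coe_add]
  rfl

/-- `t·H(t) = x₃(t) − x₀` (`X_mul_translateXSubDivX` at `t`). [cite: deShalit1987, II §4.9 (proof of (i))] -/
theorem mul_evalAt_translateXSubDivX (x₀ y₀ : A) (t : (ballNilIdeal K).toIdeal) :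
    ((t : unitBall K) : K) * ((evalAt (ballNilIdeal K) t (W.translateXSubDivX x₀ y₀) : unitBall K) : K) =
      ((evalAt (ballNilIdeal K) t (W.translateX x₀ y₀) : unitBall K) : K) - cK K x₀ := by
  have h := congrArg (fun f => ((evalAt (ballNilIdeal K) t f : unitBall K) : K)) (W.X_mul_translateXSubDivX x₀ y₀)
  simp only [map_mul, map_sub, evalAt_X', evalAt_C', Subring.coe_mul, AddSubgroupClass.coe_sub] at h
  exact h

/-- `y₃(t) = u(t)H(t) − y₀ − a₁x₃(t) − a₃` (`translateY_def'` at `t`). [cite: deShalit1987, II §4.9 (proof of (i))] -/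
theorem coe_evalAt_translateY (x₀ y₀ : A) (t : (ballNilIdeal K).toIdeal) :
    ((evalAt (ballNilIdeal K) t (W.translateY x₀ y₀) : unitBall K) : K) =
      ((evalAt (ballNilIdeal K) t (W.translateSlopeNum x₀ y₀) : unitBall K) : K) *
          ((evalAt (ballNilIdeal K) t (W.translateXSubDivX x₀ y₀) : unitBall K) : K) - cK K y₀ -
        cK K W.a₁ * ((evalAt (ballNilIdeal K) t (W.translateX x₀ y₀) : unitBall K) : K) - cK K W.a₃ := by
  rw [translateY_def', map_sub, map_sub, map_sub, map_mul, map_mul, evalAt_C', evalAt_C', evalAt_C']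
  rfl

/-! ## §2 `P₀ + P(t) = (translateX(t), translateY(t))` -/

variable [hE : (curveOver K W).IsElliptic]

/-- ★★ **`P₀ + P(t) = (translateX x₀ y₀ (t), translateY x₀ y₀ (t))` in `E(K)`** for an `A`-point `P₀ = (x₀, y₀)` and `t ∈ 𝔪_K ∖ 0`:
the translation series of `FormalGroupTranslation`, evaluated `t`-adically at the parameter of the point `P(t) ∈ E₁(K)`, are the
coordinates of the chord–tangent translate (chord case, `x₀ ≠ x(P(t))`; Mathlib's `addX`/`addY` cleared of denominators = the
evaluated identities `t²·x₃ = G`, `D·u = N`, `t·H = x₃ − x₀`).  The `p`-adic twin of `some_add_laurentPt`.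
[cite: deShalit1987, II §4.9 Proposition (proof of (ii))] [cite: SilvermanAEC2009, III.2.3, Prop. VII.2.2] -/
theorem some_add_ptOfZ {x₀ y₀ : A} (h₀ : (curveOver K W).toAffine.Nonsingular (cK K x₀) (cK K y₀))
    {t : (ballNilIdeal K).toIdeal} (ht0 : ((t : unitBall K) : K) ≠ 0) :
    ∃ h₃ : (curveOver K W).toAffine.Nonsingular ((evalAt (ballNilIdeal K) t (W.translateX x₀ y₀) : unitBall K) : K)
        ((evalAt (ballNilIdeal K) t (W.translateY x₀ y₀) : unitBall K) : K),
      (.some (cK K x₀) (cK K y₀) h₀ : (curveOver K W).toAffine.Point) + ptOfZ K W t = .some _ _ h₃ := by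
  -- names
  set s : K := ((t : unitBall K) : K) with hsdef
  set Xs : K := evX W t with hXs
  set D : K := ((evalAt (ballNilIdeal K) t (W.translateDen x₀) : unitBall K) : K) with hD
  set N : K := ((evalAt (ballNilIdeal K) t (W.translateNum y₀) : unitBall K) : K) with hN
  set u : K := ((evalAt (ballNilIdeal K) t (W.translateSlopeNum x₀ y₀) : unitBall K) : K) with hu
  set G : K := ((evalAt (ballNilIdeal K) t (W.translateXAux x₀ y₀) : unitBall K) : K) with hG
  set TX : K := ((evalAt (ballNilIdeal K) t (W.translateX x₀ y₀) : unitBall K) : K) with hTX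
  set H : K := ((evalAt (ballNilIdeal K) t (W.translateXSubDivX x₀ y₀) : unitBall K) : K) with hH
  set TY : K := ((evalAt (ballNilIdeal K) t (W.translateY x₀ y₀) : unitBall K) : K) with hTY
  have hs : s ≠ 0 := ht0
  have hD0 : D ≠ 0 := evalAt_translateDen_ne_zero x₀ t
  -- the identities at `t`
  have i1 : D = Xs - cK K x₀ * s ^ 2 := coe_evalAt_translateDen x₀ t
  have i3 : D * u = N := evalAt_translateDen_mul_translateSlopeNum x₀ y₀ t
  have i4 : s ^ 2 * TX = G := sq_mul_evalAt_translateX x₀ y₀ t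
  have i5 : G = u ^ 2 - cK K W.a₁ * s * u - Xs - (cK K W.a₂ + cK K x₀) * s ^ 2 := coe_evalAt_translateXAux x₀ y₀ t
  have i6 : s * H = TX - cK K x₀ := mul_evalAt_translateXSubDivX x₀ y₀ t
  have i7 : TY = u * H - cK K y₀ - cK K W.a₁ * TX - cK K W.a₃ := coe_evalAt_translateY x₀ y₀ t
  -- the chord
  have hx : cK K x₀ ≠ Xs / s ^ 2 := cK_ne_x_ptOfZ x₀ ht0
  have hxd : cK K x₀ - Xs / s ^ 2 = -D / s ^ 2 := cK_sub_x_ptOfZ x₀ ht0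
  have hyd : cK K y₀ - -Xs / s ^ 3 = N / s ^ 3 := cK_sub_y_ptOfZ y₀ ht0
  -- `x₃ = translateX(t)`
  have hX3 : (curveOver K W).toAffine.addX (cK K x₀) (Xs / s ^ 2)
      ((curveOver K W).toAffine.slope (cK K x₀) (Xs / s ^ 2) (cK K y₀) (-Xs / s ^ 3)) = TX := by
    have hc := chord_addX_mul (curveOver K W) (cK K y₀) (-Xs / s ^ 3) hx
    have hne : (cK K x₀ - Xs / s ^ 2) ^ 2 ≠ 0 := pow_ne_zero 2 (sub_ne_zero.mpr hx)
    refine mul_right_cancel₀ hne (hc.trans ?_)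
    rw [(curveOver_a (K := K) (W := W)).1, (curveOver_a (K := K) (W := W)).2.1]
    have hXsx : Xs / s ^ 2 = cK K x₀ + D / s ^ 2 := by
      have := hxd; linear_combination -this
    rw [hyd, hxd, hXsx, show TX = G / s ^ 2 by rw [← i4]; field_simp, i5, ← i3]
    field_simp
    rw [i1]
    ring
  -- `y₃ = translateY(t)`
  have hY3 : (curveOver K W).toAffine.addY (cK K x₀) (Xs / s ^ 2) (cK K y₀)
      ((curveOver K W).toAffine.slope (cK K x₀) (Xs / s ^ 2) (cK K y₀) (-Xs / s ^ 3)) = TY := by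
    have hc := chord_addY_mul (curveOver K W) (cK K y₀) (-Xs / s ^ 3) hx
    rw [hX3, (curveOver_a (K := K) (W := W)).1, (curveOver_a (K := K) (W := W)).2.2.1] at hc
    have hne : cK K x₀ - Xs / s ^ 2 ≠ 0 := sub_ne_zero.mpr hx
    -- `(y₃ + a₁x₃ + a₃)(x₀ − x(t)) = −(y₀ − y(t))(x₃ − x₀) − y₀(x₀ − x(t))` and the same for `TY`
    have hTYeq : (TY + cK K W.a₁ * TX + cK K W.a₃) * (cK K x₀ - Xs / s ^ 2) =
        -(cK K y₀ - -Xs / s ^ 3) * (TX - cK K x₀) - cK K y₀ * (cK K x₀ - Xs / s ^ 2) := by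
      rw [hyd, hxd, ← i6, i7, ← i3]
      field_simp
      ring
    have h := hc.trans hTYeq.symm
    exact mul_right_cancel₀ hne (by linear_combination h)
  have h₃ : (curveOver K W).toAffine.Nonsingular TX TY := by
    rw [← hX3, ← hY3]
    exact Affine.nonsingular_add h₀ (nonsingular_ptOfZ t ht0) fun h => hx h.1
  refine ⟨h₃, ?_⟩
  rw [ptOfZ_of_ne_zero ht0, Affine.Point.add_of_X_ne hx]
  simp only [Affine.Point.some.injEq]
  exact ⟨hX3, hY3⟩

/-- **The same for any point `Q ∈ E₁(K)`, at its parameter `t = z(Q)`**: `P₀ + Q = (translateX(z(Q)), translateY(z(Q)))`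
(`Q = P(z(Q))`, `eq_ptOfZ_zPt`). [cite: deShalit1987, II §4.9 Proposition (proof of (ii))] [cite: SilvermanAEC2009, Prop. VII.2.2] -/
theorem some_add_eq_of_mem_kernel {x₀ y₀ : A} (h₀ : (curveOver K W).toAffine.Nonsingular (cK K x₀) (cK K y₀))
    {Q : (curveOver K W).toAffine.Point} (hQ : Q ∈ kernel (NormedField.valuation (K := K)) (curveOver K W)) (hQ0 : Q ≠ 0) :
    ∃ h₃ : (curveOver K W).toAffine.Nonsingular ((evalAt (ballNilIdeal K) (zPt Q hQ) (W.translateX x₀ y₀) : unitBall K) : K)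
        ((evalAt (ballNilIdeal K) (zPt Q hQ) (W.translateY x₀ y₀) : unitBall K) : K),
      (.some (cK K x₀) (cK K y₀) h₀ : (curveOver K W).toAffine.Point) + Q = .some _ _ h₃ := by
  have hz0 : (((zPt Q hQ : (ballNilIdeal K).toIdeal) : unitBall K) : K) ≠ 0 := by
    intro h
    apply hQ0
    rw [eq_ptOfZ_zPt hQ, ptOfZ_of_eq_zero h]
  obtain ⟨h₃, e⟩ := some_add_ptOfZ (W := W) h₀ hz0
  exact ⟨h₃, by rw [← e, ← eq_ptOfZ_zPt hQ]⟩

/-! ## §3 `P₀ − P(t)`: the series `(translateX x₀ y₀) ∘ i_W`, `(translateY x₀ y₀) ∘ i_W` -/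

/-- ★ **`P₀ − P(t) = (((translateX x₀ y₀) ∘ i_W)(t), ((translateY x₀ y₀) ∘ i_W)(t))`** (`t ≠ 0`): de Shalit's series — the
`t`-expansion of `x(P₀ − P)` is `(translateX x₀ y₀).subst W.formalNeg` (the tree's `DeShalitThetaTExpansion`), and its
`t`-adic value at the parameter of `P(t)` is the `x`-coordinate of `P₀ − P(t)` (`−P(t) = P(i_W(t))`, `neg_ptOfZ`; `(h ∘ i_W)(t) =
h(i_W t)`, `evalAt_subst₁`). [cite: deShalit1987, II §4.9 Proposition (proof of (ii))] [cite: SilvermanAEC2009, Prop. VII.2.2] -/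
theorem some_sub_ptOfZ {x₀ y₀ : A} (h₀ : (curveOver K W).toAffine.Nonsingular (cK K x₀) (cK K y₀))
    {t : (ballNilIdeal K).toIdeal} (ht0 : ((t : unitBall K) : K) ≠ 0) :
    ∃ h₃ : (curveOver K W).toAffine.Nonsingular
        ((evalAt (ballNilIdeal K) t ((W.translateX x₀ y₀).subst W.formalNeg) : unitBall K) : K)
        ((evalAt (ballNilIdeal K) t ((W.translateY x₀ y₀).subst W.formalNeg) : unitBall K) : K),
      (.some (cK K x₀) (cK K y₀) h₀ : (curveOver K W).toAffine.Point) - ptOfZ K W t = .some _ _ h₃ := by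
  have hi0 := evalPt₁_formalNeg_ne_zero (W := W) (K := K) ht0
  obtain ⟨h₃, e⟩ := some_add_ptOfZ (W := W) h₀ hi0
  rw [evalAt_subst₁ t W.formalNeg W.constantCoeff_formalNeg, evalAt_subst₁ t W.formalNeg W.constantCoeff_formalNeg]
  exact ⟨h₃, by rw [sub_eq_add_neg, neg_ptOfZ, e]⟩

/-- **The same for any `Q ∈ E₁(K) ∖ O`**: `P₀ − Q = (((translateX x₀ y₀) ∘ i_W)(z(Q)), ((translateY x₀ y₀) ∘ i_W)(z(Q)))` — the
value de Shalit substitutes in II.4.9 (ii) (`Q = ξ(u_n)`, `z(Q) = ω_n`). [cite: deShalit1987, II §4.9 Proposition (ii), II §4.4 (12)] -/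
theorem some_sub_eq_of_mem_kernel {x₀ y₀ : A} (h₀ : (curveOver K W).toAffine.Nonsingular (cK K x₀) (cK K y₀))
    {Q : (curveOver K W).toAffine.Point} (hQ : Q ∈ kernel (NormedField.valuation (K := K)) (curveOver K W)) (hQ0 : Q ≠ 0) :
    ∃ h₃ : (curveOver K W).toAffine.Nonsingular
        ((evalAt (ballNilIdeal K) (zPt Q hQ) ((W.translateX x₀ y₀).subst W.formalNeg) : unitBall K) : K)
        ((evalAt (ballNilIdeal K) (zPt Q hQ) ((W.translateY x₀ y₀).subst W.formalNeg) : unitBall K) : K),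
      (.some (cK K x₀) (cK K y₀) h₀ : (curveOver K W).toAffine.Point) - Q = .some _ _ h₃ := by
  have hz0 : (((zPt Q hQ : (ballNilIdeal K).toIdeal) : unitBall K) : K) ≠ 0 := by
    intro h
    apply hQ0
    rw [eq_ptOfZ_zPt hQ, ptOfZ_of_eq_zero h]
  obtain ⟨h₃, e⟩ := some_sub_ptOfZ (W := W) h₀ hz0
  exact ⟨h₃, by rw [← e, ← eq_ptOfZ_zPt hQ]⟩

end Literature.NumberTheory.EllipticCurves
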